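import Summits.ResolutionOfSingularities.ResolutionOfSingularities.Theses.VerticalModels

/-!
# `WildCoreResolution`, line `birth`: the parameter `a^p (1 + a)` is DEEPLY WILD
# (negative-side support for `stub-false: stub_radicialTameTop`, refuter vetting seat)

Crux `stmt-ResolutionOfSingularities-16197`
(`Summit.ResolutionOfSingularities.ResolutionOfSingularities.Theses.VerticalModels.WildCoreResolution`),
registered skeleton `Cruxes/WildCoreResolution/Lines/birth.lean`, load-bearing stub `stub_radicialTameTop`
("every wild-core vertical datum `(X, t)` is the bottom of a finite radicial `g : Y → X` carrying a ROOT
`s`, `s^(p^e) = g^* t`, such that near `V(s)` every point of `Y` that is not tame-reachable for `s` — no arc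
`Spec k'⟦X⟧ → Y` through it pulls `s` back with order prime to `p` — is regular").

The stub is false (evidence file `stubs/stub_radicialTameTop.md` on the item): on the normal surface
`X = Spec 𝔽_p[a,b,c]/(ac - b^ℓ)`, `ℓ ≠ p` prime, with `t = a^p (1 + a)`, the point over the vertex of ANY finite
radicial cover is (A′) never regular (class-group parity: `[ruling]` has order `ℓ`, radicial degrees are powers
of `p`) and (B′) never tame-reachable for ANY root `s` of `t` on the cover.  This file kernel-checks the
power-series heart of (B′), which is pure algebra in `k'⟦X⟧`, `char k' = p`:

* `exists_order_eq_mul` : if `α(0) = 0`, `α ≠ 0` and `α^p (1 + α) = w^(p^e)` then `ord w = p·n` for some `n`;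
* `dvd_of_order_eq`     : hence `ord w = m ∈ ℕ` forces `p ∣ m` — along an arc `ψ` of the cover centred over the
  vertex, `α := ψ^*(g^* a)` and `w := ψ^* s` satisfy exactly these hypotheses (`α(0) = 0` because `a` vanishes
  at the vertex; `w^(p^e) = ψ^*(s^(p^e)) = ψ^*(g^* t) = α^p (1 + α)`), so NO arc makes the vertex tame, for
  any `e` and any cover: extracting `p^e`-th roots of `t` never lowers the `p`-part of arc orders.

Proof: induction on `e`.  `e = 0`: `ord (α^p (1+α)) = p · ord α`.  `e + 1 → e` (`descend`): strip the
`X`-powers with the monoid hom `divXPowOrder` to get `u^p (1 + α) = v^(p^(e+1))` between units, so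
`1 + α = c^p` with `c = v^(p^e) u⁻¹`, whence `α = (c - 1)^p` (Frobenius) and, by injectivity of Frobenius
on the domain `k'⟦X⟧`, `(c-1)^p (1 + (c-1)) = w^(p^e)`: the same shape one level down.
Moral for the planner/lead: the ROOT clause `s^(p^e) = g^* t` of `stub_radicialTameTop` cannot create tame
arcs at a deeply wild point; the composition `WildCoreResolution_of` only consumes
`fibreLocus Y s = fibreLocus Y (g^* t)`, and with that clause instead (`s := a(1+a)` on `Y = X`) the vertex IS
tame — see the evidence file for the repaired stub C′.
-/

set_option linter.dupNamespace false -- mandated namespace of this single-conjunct summit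

namespace Summit.ResolutionOfSingularities.ResolutionOfSingularities.Theorems.WildCoreResolution.Negative

open PowerSeries

variable {k : Type*} [Field k] {p : ℕ} [hp : Fact p.Prime] [CharP k p]

omit hp in
/-- `k⟦X⟧` has characteristic `p` when `k` has (transfer along the injective `C`). [folklore] -/
theorem charP_powerSeries : CharP k⟦X⟧ p :=
  charP_of_injective_ringHom (PowerSeries.C_injective (R := k)) p

omit hp [CharP k p] in
/-- A power series with constant coefficient `0` becomes a unit after adding `1`. [folklore] -/
theorem isUnit_one_add (α : k⟦X⟧) (h0 : constantCoeff α = 0) : IsUnit (1 + α) := by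
  rw [isUnit_iff_constantCoeff, map_add, map_one, h0, add_zero]
  exact isUnit_one

omit hp [CharP k p] in
/-- A unit power series is its own `X`-stripped part. [folklore] -/
theorem divXPowOrder_eq_self_of_isUnit {f : k⟦X⟧} (hf : IsUnit f) : divXPowOrder f = f :=
  ((eq_divided_by_X_pow_order_Iff_Unit hf.ne_zero).mpr hf).symm

/-- **Frobenius descent step.** If `α(0) = 0`, `α ≠ 0` and `α^p (1 + α) = w^(p^(e+1))` in `k⟦X⟧`,
`char k = p`, then `α = α₁^p` for an `α₁` with `α₁(0) = 0`, `α₁ ≠ 0` and `α₁^p (1 + α₁) = w^(p^e)`.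
[folklore] -/
theorem descend {e : ℕ} {α w : k⟦X⟧} (h0 : constantCoeff α = 0) (hα : α ≠ 0)
    (h : α ^ p * (1 + α) = w ^ (p ^ (e + 1))) :
    ∃ α₁ : k⟦X⟧, constantCoeff α₁ = 0 ∧ α₁ ≠ 0 ∧ α₁ ^ p * (1 + α₁) = w ^ (p ^ e) := by
  haveI : CharP k⟦X⟧ p := charP_powerSeries
  haveI : ExpChar k⟦X⟧ p := ExpChar.prime hp.out
  have hp0 : p ≠ 0 := hp.out.ne_zero
  have hu1 : IsUnit (1 + α) := isUnit_one_add α h0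
  -- strip the powers of `X`
  have hD := congrArg divXPowOrder h
  rw [divXPowOrder_mul, divXPowOrder_pow, divXPowOrder_pow,
    divXPowOrder_eq_self_of_isUnit hu1] at hD
  obtain ⟨u, hu⟩ := isUnit_divided_by_X_pow_order hα
  -- hD : (divXPowOrder α) ^ p * (1 + α) = (divXPowOrder w) ^ (p ^ (e + 1))
  set v := divXPowOrder w with hv
  set c : k⟦X⟧ := v ^ (p ^ e) * ↑u⁻¹ with hc_def
  have hvpow : v ^ (p ^ (e + 1)) = (v ^ (p ^ e)) ^ p := by rw [pow_succ, pow_mul]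
  have hc : c ^ p = 1 + α := by
    calc c ^ p = (v ^ (p ^ e)) ^ p * ((↑u⁻¹ : k⟦X⟧)) ^ p := by rw [hc_def, mul_pow]
      _ = (↑u : k⟦X⟧) ^ p * (1 + α) * ((↑u⁻¹ : k⟦X⟧)) ^ p := by rw [← hvpow, ← hD, hu]
      _ = 1 + α := by
          rw [mul_comm ((↑u : k⟦X⟧) ^ p) (1 + α), mul_assoc, ← mul_pow, Units.mul_inv, one_pow,
            mul_one]
  have hα' : α = (c - 1) ^ p := by
    rw [sub_pow_char, hc, one_pow, add_sub_cancel_left]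
  refine ⟨c - 1, ?_, ?_, ?_⟩
  · have h1 := congrArg constantCoeff hα'
    rw [map_pow, h0] at h1
    exact (pow_eq_zero_iff hp0).mp h1.symm
  · intro hc1
    apply hα
    rw [hα', hc1, zero_pow hp0]
  · apply frobenius_inj k⟦X⟧ p
    rw [frobenius_def, frobenius_def, mul_pow, ← hα', add_sub_cancel, hc, ← pow_mul, ← pow_succ, h]

/-- **`a^p (1+a)` is deeply wild (order form).** In `k⟦X⟧` with `char k = p`: if `α(0) = 0`, `α ≠ 0`
and `α^p (1 + α) = w^(p^e)`, then the order of `w` is `p · n` for some natural number `n` — for every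
`e`. [folklore] -/
theorem exists_order_eq_mul (e : ℕ) :
    ∀ {α w : k⟦X⟧}, constantCoeff α = 0 → α ≠ 0 → α ^ p * (1 + α) = w ^ (p ^ e) →
      ∃ n : ℕ, w.order = ((p * n : ℕ) : ℕ∞) := by
  induction e with
  | zero =>
    intro α w h0 hα h
    rw [pow_zero, pow_one] at h
    obtain ⟨a, ha⟩ : ∃ a : ℕ, α.order = a := ⟨_, (coe_toNat_order hα).symm⟩
    refine ⟨a, ?_⟩
    rw [← h, order_mul, order_pow, order_zero_of_unit (isUnit_one_add α h0), add_zero, ha,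
      nsmul_eq_mul, Nat.cast_mul]
  | succ e ih =>
    intro α w h0 hα h
    obtain ⟨α₁, h0₁, hα₁, h₁⟩ := descend h0 hα h
    exact ih h0₁ hα₁ h₁

/-- **`a^p (1+a)` is deeply wild (divisibility form used against `TameReachable`).** With `α, w` as
above (`α = 0` allowed: then `w = 0` has no finite order), a finite order `ord w = m` is divisible by `p`;
in particular there is no `m` with `ord w = m ∧ ¬ p ∣ m`. [folklore] -/
theorem dvd_of_order_eq (e : ℕ) {α w : k⟦X⟧} (h0 : constantCoeff α = 0)
    (h : α ^ p * (1 + α) = w ^ (p ^ e)) {m : ℕ} (hm : w.order = m) : p ∣ m := by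
  by_cases hα : α = 0
  · exfalso
    have hw : w = 0 := by
      apply pow_eq_zero_iff (pow_ne_zero e hp.out.ne_zero) |>.mp
      rw [← h, hα, zero_pow hp.out.ne_zero, zero_mul]
    rw [hw, order_zero] at hm
    exact ENat.top_ne_coe m hm
  · obtain ⟨n, hn⟩ := exists_order_eq_mul e h0 hα h
    rw [hm] at hn
    exact ⟨n, by exact_mod_cast hn⟩

/-- The shape in which the skeleton's `TameReachable` clause consumes it: no finite order prime to `p`.
[folklore] -/
theorem not_exists_order_coprime (e : ℕ) {α w : k⟦X⟧} (h0 : constantCoeff α = 0)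
    (h : α ^ p * (1 + α) = w ^ (p ^ e)) : ¬ ∃ m : ℕ, w.order = m ∧ ¬ p ∣ m :=
  fun ⟨_, hm, hpm⟩ => hpm (dvd_of_order_eq e h0 h hm)

end Summit.ResolutionOfSingularities.ResolutionOfSingularities.Theorems.WildCoreResolution.Negative
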